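/-
Copyright (c) 2026 the pub-hodgecm-mathlib formalisation cell (harness21).  Prover seat hodgecm-mathlib-K2E4-p21 (g0) (outside hand on the E3 WILD CHAIN, K2E3-plan (g1) DEALS BATCH #2
22:15:20Z, line lead K2E3-p17 (g0)), Track B «K2-LIT» ∕ h413, unit U5Kazhdan of the line `K2_E3_EllipticInputs`: the WILD twin of E1 row B3(48)-RAM FILE 2 «THE HEAD».  2026-09-03.
-/
import Summits.HodgeConjecture.HodgeConjecture.Theorems.F0P3cStCharTSEPFunctionOrbitalEllipticRamified  -- ★ 48-RAM FILE 2 (p06 (g26)): the PLACE-FREE head `…_of_involution` (used BY NAME) + tame `_of_neg`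
import Summits.HodgeConjecture.HodgeConjecture.Theorems.K2E3EPFunctionOrbitalOrbitsWild                  -- ★ 48-W FILE 1 (K2E3-p17): `exists_mapEdgeSet_eq_of_ramificationIdx_ne_one` (`htrE` at every ramified place); brings the wild datum letters
import HarnessLib

/-!
# K2_E3 road (h413 = stmt-HodgeConjecture-24833), unit U5Kazhdan — THE WILD ENGINE, mechanical layer, FILE «48-W ∕ 2» (THE HEAD): the orbital integral of an Euler–Poincaré sum of
# `K`-type functions on `G_v = U(Φ₃)(L⁺_v)` at a regular elliptic class, unfolded over the `γ`-fixed vertices and edges of the tree, AT EVERY RAMIFIED PLACE (tame re-proved, WILD = dyadic new)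

Cell `pub/hodgecm-mathlib` (D-0151), Track B; seat K2E4-p21 (g0) as outside hand on the E3 wild chain (K2E3-plan (g1) DEALS BATCH #2 22:15:20Z «default 47e∕48-W»; line lead K2E3-p17 (g0),
whose ★ 48-W FILE 1 `K2E3EPFunctionOrbitalOrbitsWild` is the template and the supplier of `htrE`).  THEOREMS ONLY (no definition ∕ instance ∕ notation ∕ named fact ∕ `sorry`); ★-only imports
(never a `Cruxes/…/Lines` module); `--supports stmt-HodgeConjecture-24833 --as helper`.

WHAT.  ★ 48-RAM FILE 2 `F0P3cStCharTSEPFunctionOrbitalEllipticRamified` states the HEAD `classOrbitalIntegral_epSum_eq_fixedVertexSum_sub_fixedEdgeSum_of_involution` PLACE-FREE (place letters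
`hvσ hϖ`, facet-orbit transitivities `htr₀ htr₂ htrE` hypothesis-style) and discharges it at a TAME ramified place (`_of_neg`: the seven tame letters `hσ hvσ hϖ hσϖ hres h2 hnorm`, among them
`h2 : |2|_w = 1`).  THIS FILE discharges the SAME head at EVERY RAMIFIED place `w ∣ v` (`he : e(w∣v) ≠ 1`), ANY uniformiser (`hϖ : |ϖ|_w = q⁻¹`), with NO hypothesis on `|2|_w` — so at the
WILD (dyadic) places too — by reading the letters at Track A U0's RAMIFIED QUADRATIC DATUM `IsRamifiedQuadraticDatum σ_w ϖ d t` (★ `exists_isRamifiedQuadraticDatum_of_placesOver`, no parity ∕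
tameness condition): `hvσ` := the datum's `|σ_w ·| = |·|`, `htr₀` := ★ htr₀-WILD `exists_unitary_mapGL_stdLattice_eq_of_isSelfDualLattice_of_ramified` (p854568), `htr₂` := ★
`htr₂_of_isRamifiedQuadraticDatum` (p854580), `htrE` := ★ 48-W FILE 1 `exists_mapEdgeSet_eq_of_ramificationIdx_ne_one` (K2E3-p17, over ★ `flagTransitive_of_isRamifiedQuadraticDatum`).
Statement = the tame discharger `_of_neg` VERBATIM with the single binder substitution «tame block `(hσ hvσ hϖ hσϖ hres h2 hnorm)` ↦ `(he) (hϖ)`» (p855067's ∕ 48-W FILE 1's convention),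
conclusion byte-identical; name `…_of_ramificationIdx_ne_one`.
* **`classOrbitalIntegral_epSum_eq_fixedVertexSum_sub_fixedEdgeSum_of_ramificationIdx_ne_one`** —
  `Φ^{can}(γ, (ν P₀)⁻¹ f₀ + (ν P₂)⁻¹ f₂ − (ν P₁)⁻¹ f₁) = Σ_{x ∈ X^γ⁰} Θ_{U_x}(γ⁻¹) − Σ_{d ∈ X^γ¹} Θ_{U_d}(γ⁻¹)` at every ramified `w ∣ v`.
Consumers (the next files of the layer): B3(53)-W, 61b-W, 58-W-W, and through them 17W ∕ 73-W (`sig_K2E3EPNormOneWild`) ∕ X0′-W.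

HONEST LABEL: HC_CM is proved only modulo the 7 printed citations (2 remaining named inputs: hLiu418 = stmt-HodgeConjecture-24832, h413 = stmt-HodgeConjecture-24833) until rung 0
closes; count-neutral helper (a brick of rows #17∕#15∕#16∕#18's wild residue); retires nothing by itself.

## References
* [SchneiderStuhler1997] P. Schneider, U. Stuhler, *Representation theory and sheaves on the Bruhat–Tits building*, Publ. Math. IHÉS 85 (1997): §III.4.
* [Kottwitz1988] R. E. Kottwitz, *Tamagawa numbers*, Ann. of Math. 127 (1988): §2.
* [Rogawski1990] J. D. Rogawski, *Automorphic Representations of Unitary Groups in Three Variables* (1990): §4.9 p. 54, §12.5 pp. 182–187.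
* [BruhatTits1972] F. Bruhat, J. Tits, *Groupes réductifs sur un corps local* I, Publ. Math. IHÉS 41 (1972): §10.
* [Jacobowitz1962] R. Jacobowitz, *Hermitian forms over local fields*, Amer. J. Math. 84 (1962): §4–§8.
-/

set_option autoImplicit false
-- the mandated namespace has the single-problem summit's repeated segment (`HodgeConjecture.HodgeConjecture`)
set_option linter.dupNamespace false

noncomputable section

open NumberField IsDedekindDomain MeasureTheory Measure
open scoped Pointwise Valued WithZero Matrix MatrixGroups
open Literature.NumberTheory.Rogawski1990 Literature.NumberTheory.Rogawski1990.Ch12Sec5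
open Literature.NumberTheory.Automorphic Literature.NumberTheory.Automorphic.UnitaryGroup Literature.NumberTheory.Automorphic.UnitaryLatticeTree
open Literature.NumberTheory.Automorphic.HermitianLattice Literature.NumberTheory.GaloisRepresentations
open Literature.Combinatorics.SimpleGraph Literature.Combinatorics.SimpleGraph.OrientedIncidence
open Literature.NumberTheory.Automorphic.UnitaryThreeFourFrame

namespace Summit.HodgeConjecture.HodgeConjecture.Cruxes.H413.K2E3EPFunctionOrbitalEllipticWild

open Summit.HodgeConjecture.HodgeConjecture.Cruxes.H413
open Summit.HodgeConjecture.HodgeConjecture.Cruxes.H413.F0P3cStCharTSCharacterEllipticUniform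
open Summit.HodgeConjecture.HodgeConjecture.Cruxes.H413.F0P3cStCharTSEPFunctionOrbitalOrbits
open Summit.HodgeConjecture.HodgeConjecture.Cruxes.H413.F0P3cStCharTSEPFunctionOrbitalOrbitsRamified
open Summit.HodgeConjecture.HodgeConjecture.Cruxes.H413.F0P3cStCharTSEPFunctionOrbitalEllipticRamified
open Summit.HodgeConjecture.HodgeConjecture.Cruxes.H413.K2E3EPFunctionOrbitalOrbitsWild
open Summit.HodgeConjecture.HodgeConjecture.Cruxes.H413.F0P3cDyRamWildPlaceDatum
open Summit.HodgeConjecture.HodgeConjecture.Cruxes.H413.F0P3cDyRamWildTransitivity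

section Head

variable (L : Type) [Field L] [NumberField L] [IsCMField L] (v : HeightOneSpectrum (𝓞 ↥(maximalRealSubfield L)))

set_option maxHeartbeats 1600000 in
/-- **(SS-O) AT THE DATUM AT EVERY RAMIFIED PLACE — TAME OR WILD** (`he : e(w∣v) ≠ 1`, any uniformiser, NO `|2|_w` hypothesis): ★ 48-RAM FILE 2's HEAD `…_of_involution` with its place ∕ orbit
letters read at the ramified quadratic datum (★ `exists_isRamifiedQuadraticDatum_of_placesOver`): `hvσ` from the datum, `htr₀` by ★ `exists_unitary_mapGL_stdLattice_eq_of_isSelfDualLattice_of_ramified`,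
`htr₂` by ★ `htr₂_of_isRamifiedQuadraticDatum`, `htrE` by ★ 48-W FILE 1 `exists_mapEdgeSet_eq_of_ramificationIdx_ne_one`; every other binder and the conclusion VERBATIM from the tame `_of_neg`.
[cite: SchneiderStuhler1997, §III.4] [cite: Kottwitz1988, §2 Theorem 2] [cite: Rogawski1990, §4.9 p. 54; §12.5 pp. 182–187] [cite: BruhatTits1972, §10] [cite: Jacobowitz1962, §8] -/
theorem classOrbitalIntegral_epSum_eq_fixedVertexSum_sub_fixedEdgeSum_of_ramificationIdx_ne_one
    (w : PlacesOver L v) (hw : IsCMField.complexConj L • w.1 = w.1) {ϖ : (w.1.adicCompletion L)}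
    (he : v.asIdeal.ramificationIdx' w.1.asIdeal ≠ 1) (hϖ : Valued.v ϖ = WithZero.exp (-1 : ℤ))
    (eA : (Gqs L v) ≃ₜ* ↥(unitaryGroupOfForm (galAdicCompletionMap (L := L) (IsCMField.complexConj L) hw) ((StdForm.antidiagonal 3).over (w.1.adicCompletion L))))
    {a : (Gqs L v) →* ((latticeGraph (galAdicCompletionMap (L := L) (IsCMField.complexConj L) hw) ϖ ((StdForm.antidiagonal 3).over (w.1.adicCompletion L))) ≃g (latticeGraph (galAdicCompletionMap (L := L) (IsCMField.complexConj L) hw) ϖ ((StdForm.antidiagonal 3).over (w.1.adicCompletion L))))} (ha : ∀ g, a g = latticeGraphIso (galAdicCompletionMap (L := L) (IsCMField.complexConj L) hw) ϖ ((StdForm.antidiagonal 3).over (w.1.adicCompletion L)) (eA g))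
    [MeasurableSpace (Gqs L v)] [BorelSpace (Gqs L v)]
    [∀ γ : (Gqs L v), MeasurableSpace ((Gqs L v) ⧸ Subgroup.centralizer ({γ} : Set (Gqs L v)))]
    [∀ γ : (Gqs L v), BorelSpace ((Gqs L v) ⧸ Subgroup.centralizer ({γ} : Set (Gqs L v)))]
    (νQv : Measure (Gqs L v)) [νQv.IsHaarMeasure] [νQv.IsMulRightInvariant]
    {mQv : OrbitalMeasureFamily (Gqs L v)} (hcanQ : mQv.IsCanonical (fun γ => IsRegularElt (γ.val : GL (Fin 3) (UnitaryGroup.LocalRing L v))) νQv)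
    (τ : Orientation (latticeGraph (galAdicCompletionMap (L := L) (IsCMField.complexConj L) hw) ϖ ((StdForm.antidiagonal 3).over (w.1.adicCompletion L)))) (hτ : ∀ d, τ.tail d < τ.head d)
    {e : ℕ} {U : {M : Submodule 𝒪[(w.1.adicCompletion L)] (Fin 3 → (w.1.adicCompletion L)) // IsVertex (galAdicCompletionMap (L := L) (IsCMField.complexConj L) hw) ϖ ((StdForm.antidiagonal 3).over (w.1.adicCompletion L)) M} → Subgroup (Gqs L v)}
    (hU : ∀ x g, g ∈ U x ↔ mapGL ((eA g : ↥(unitaryGroupOfForm (galAdicCompletionMap (L := L) (IsCMField.complexConj L) hw) ((StdForm.antidiagonal 3).over (w.1.adicCompletion L)))) : GL (Fin 3) (w.1.adicCompletion L)) x.1 = x.1 ∧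
      x.1.map ((Matrix.toLin' ((((eA g : ↥(unitaryGroupOfForm (galAdicCompletionMap (L := L) (IsCMField.complexConj L) hw) ((StdForm.antidiagonal 3).over (w.1.adicCompletion L)))) : GL (Fin 3) (w.1.adicCompletion L)) : Matrix (Fin 3) (Fin 3) (w.1.adicCompletion L)) - 1)).restrictScalars 𝒪[(w.1.adicCompletion L)]) ≤ scaleLattice (ϖ ^ (e + 1)) x.1)
    (hUo : ∀ x, IsOpen (U x : Set (Gqs L v))) (hUc : ∀ x, IsCompact (U x : Set (Gqs L v)))
    (hEo : ∀ d : (latticeGraph (galAdicCompletionMap (L := L) (IsCMField.complexConj L) hw) ϖ ((StdForm.antidiagonal 3).over (w.1.adicCompletion L))).edgeSet, IsOpen ((U (τ.head d) ⊔ U (τ.tail d) : Subgroup (Gqs L v)) : Set (Gqs L v)))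
    (hEc : ∀ d : (latticeGraph (galAdicCompletionMap (L := L) (IsCMField.complexConj L) hw) ϖ ((StdForm.antidiagonal 3).over (w.1.adicCompletion L))).edgeSet, IsCompact ((U (τ.head d) ⊔ U (τ.tail d) : Subgroup (Gqs L v)) : Set (Gqs L v)))
    (d₁ : (latticeGraph (galAdicCompletionMap (L := L) (IsCMField.complexConj L) hw) ϖ ((StdForm.antidiagonal 3).over (w.1.adicCompletion L))).edgeSet) (P₀ P₂ P₁ : Subgroup (Gqs L v))
    (hP₀ : ∀ g, g ∈ P₀ ↔ a g (τ.head d₁) = τ.head d₁) (hP₂ : ∀ g, g ∈ P₂ ↔ a g (τ.tail d₁) = τ.tail d₁) (hP₁ : ∀ g, g ∈ P₁ ↔ (a g).mapEdgeSet d₁ = d₁)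
    {V : Type*} [AddCommGroup V] [Module ℂ V] (ρ : Representation ℂ (Gqs L v) V)
    [FiniteDimensional ℂ ↥(ρ.fixedPoints (U (τ.head d₁)))] [FiniteDimensional ℂ ↥(ρ.fixedPoints (U (τ.tail d₁)))]
    [FiniteDimensional ℂ ↥(ρ.fixedPoints (U (τ.head d₁) ⊔ U (τ.tail d₁)))]
    (τ₀ : Representation ℂ ↥P₀ ↥(ρ.fixedPoints (U (τ.head d₁))))
    (hτρ₀ : ∀ (p : ↥P₀) (x : ↥(ρ.fixedPoints (U (τ.head d₁)))), ((τ₀ p x : ↥(ρ.fixedPoints (U (τ.head d₁)))) : V) = ρ (p : (Gqs L v)) (x : V))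
    (hτ₀ : ∀ p : ↥P₀, (p : (Gqs L v)) ∈ U (τ.head d₁) → τ₀ p = 1)
    (τ₂ : Representation ℂ ↥P₂ ↥(ρ.fixedPoints (U (τ.tail d₁))))
    (hτρ₂ : ∀ (p : ↥P₂) (x : ↥(ρ.fixedPoints (U (τ.tail d₁)))), ((τ₂ p x : ↥(ρ.fixedPoints (U (τ.tail d₁)))) : V) = ρ (p : (Gqs L v)) (x : V))
    (hτ₂ : ∀ p : ↥P₂, (p : (Gqs L v)) ∈ U (τ.tail d₁) → τ₂ p = 1)
    (τ₁ : Representation ℂ ↥P₁ ↥(ρ.fixedPoints (U (τ.head d₁) ⊔ U (τ.tail d₁))))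
    (hτρ₁ : ∀ (p : ↥P₁) (x : ↥(ρ.fixedPoints (U (τ.head d₁) ⊔ U (τ.tail d₁)))), ((τ₁ p x : ↥(ρ.fixedPoints (U (τ.head d₁) ⊔ U (τ.tail d₁)))) : V) = ρ (p : (Gqs L v)) (x : V))
    (hτ₁ : ∀ p : ↥P₁, (p : (Gqs L v)) ∈ U (τ.head d₁) ⊔ U (τ.tail d₁) → τ₁ p = 1)
    {f₀ f₂ f₁ : (Gqs L v) → ℂ}
    (hfP₀ : ∀ (g : (Gqs L v)) (hg : g ∈ P₀), f₀ g = Representation.character τ₀ ⟨g, hg⟩⁻¹) (hf0₀ : ∀ g ∉ P₀, f₀ g = 0)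
    (hfP₂ : ∀ (g : (Gqs L v)) (hg : g ∈ P₂), f₂ g = Representation.character τ₂ ⟨g, hg⟩⁻¹) (hf0₂ : ∀ g ∉ P₂, f₂ g = 0)
    (hfP₁ : ∀ (g : (Gqs L v)) (hg : g ∈ P₁), f₁ g = Representation.character τ₁ ⟨g, hg⟩⁻¹) (hf0₁ : ∀ g ∉ P₁, f₁ g = 0)
    {γ : (Gqs L v)} (hreg : IsRegularElt (γ.val : GL (Fin 3) (UnitaryGroup.LocalRing L v)))
    (hell : IsCompact ((Subgroup.centralizer ({γ} : Set (Gqs L v))) : Set (Gqs L v)))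
    (hfin : {x : {M : Submodule 𝒪[(w.1.adicCompletion L)] (Fin 3 → (w.1.adicCompletion L)) // IsVertex (galAdicCompletionMap (L := L) (IsCMField.complexConj L) hw) ϖ ((StdForm.antidiagonal 3).over (w.1.adicCompletion L)) M} | a γ x = x}.Finite) (hfinE : {d : (latticeGraph (galAdicCompletionMap (L := L) (IsCMField.complexConj L) hw) ϖ ((StdForm.antidiagonal 3).over (w.1.adicCompletion L))).edgeSet | (a γ).mapEdgeSet d = d}.Finite) :
    classOrbitalIntegral mQv
        ((((νQv.real (P₀ : Set (Gqs L v)))⁻¹ : ℂ)) • f₀ + (((νQv.real (P₂ : Set (Gqs L v)))⁻¹ : ℂ)) • f₂ - (((νQv.real (P₁ : Set (Gqs L v)))⁻¹ : ℂ)) • f₁) (ConjClasses.mk γ) =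
      (∑ x ∈ hfin.toFinset, ρ.levelTrace (hUo x) (hUc x) γ⁻¹) - ∑ d ∈ hfinE.toFinset, ρ.levelTrace (hEo d) (hEc d) γ⁻¹ := by
  letI : Fintype 𝓀[w.1.adicCompletion L] := Fintype.ofFinite _
  obtain ⟨nd, nt, hD⟩ := exists_isRamifiedQuadraticDatum_of_placesOver L w hw he ϖ hϖ
  have hD' := hD
  obtain ⟨hσ, hvσ, -, heven, hd, h1d, h2t⟩ := hD'
  exact classOrbitalIntegral_epSum_eq_fixedVertexSum_sub_fixedEdgeSum_of_involution L v w hw hvσ hϖ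
    (exists_unitary_mapGL_stdLattice_eq_of_isSelfDualLattice_of_ramified hσ hvσ hϖ heven hd h1d h2t)
    (htr₂_of_isRamifiedQuadraticDatum hD) eA ha
    (exists_mapEdgeSet_eq_of_ramificationIdx_ne_one L v w hw he hϖ eA ha τ hτ) νQv hcanQ τ hτ hU hUo hUc hEo hEc d₁ P₀ P₂ P₁ hP₀ hP₂ hP₁ ρ
    τ₀ hτρ₀ hτ₀ τ₂ hτρ₂ hτ₂ τ₁ hτρ₁ hτ₁ hfP₀ hf0₀ hfP₂ hf0₂ hfP₁ hf0₁ hreg hell hfin hfinE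

end Head

end Summit.HodgeConjecture.HodgeConjecture.Cruxes.H413.K2E3EPFunctionOrbitalEllipticWild

end
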